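import Literature.AlgebraicGeometry.Resolution.DimensionFormula
import Mathlib.RingTheory.QuasiFinite.Basic
import Mathlib.RingTheory.EssentialFiniteness
import Mathlib.RingTheory.LocalRing.Quotient
import Mathlib.RingTheory.LocalRing.ResidueField.Basic
import Mathlib.RingTheory.Flat.Localization
import Mathlib.RingTheory.PolynomialAlgebra
import HarnessLib

/-!
# Local dimension along quasi-finite, essentially finite-type local homomorphisms
# (Matsumura Thm. 15.5 ∕ 15.6 in local form; EGA IV₂ 5.6.4, 5.6.5)

Topic `Literature/RingTheory/KrullDimension`; namespace `Literature.RingTheory.KrullDimension`.  THEOREMS ONLY (no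
definition, no named fact, no `sorry`, no axiom, no instance).  This file turns the tree's DIMENSION FORMULA
(★ `Literature.AlgebraicGeometry.Resolution.DimensionFormula`: Matsumura Thm. 15.5 `ht P ≤ ht p` and Thm. 15.6 `ht P = ht p`
for `A ⊆ B` finitely generated and algebraic, `B/P` algebraic over `A/p`, `A` universally catenary) into the form in which
scheme theory consumes it: a LOCAL homomorphism `A → T` of local rings which is QUASI-FINITE (Mathlib `Algebra.QuasiFinite`:
finite fibre rings) and ESSENTIALLY OF FINITE TYPE (Mathlib `Algebra.EssFiniteType`: `T` is a localization of a finitely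
generated `A`-subalgebra) — e.g. the stalk map `𝒪_{Y,f x} → 𝒪_{X,x}` of a morphism locally of finite type and locally
quasi-finite (Mathlib `LocallyOfFiniteType.stalkMap`, `Scheme.Hom.quasiFiniteAt`).

* `isAlgebraic_of_quasiFinite` — a quasi-finite algebra over a domain is algebraic (the generic fibre
  `Frac(A) ⊗_A T` is finite over `Frac(A)`, so no `A[X]` embeds).
* `exists_maximalIdeal_pow_le_map_of_quasiFinite` — along a quasi-finite local homomorphism `R → S`, `𝔪_R S` is
  `𝔪_S`-primary: `𝔪_Sᴺ ⊆ 𝔪_R S` (the closed fibre `S/𝔪_R S` is finite over the residue field, hence Artinian); the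
  local-homomorphism form (no Noetherian hypothesis) of ★ `AlgebraicGeometry.Morphisms.QuasiFiniteStalkPrimary`'s
  lemma of the same name (stated there for localizations `R_𝔭 → S_𝔮` of a quasi-finite `R → S`, `S` Noetherian).
* `finite_quotient_maximalIdeal_of_quasiFinite` — the residue algebra `T/𝔪_T` is finite over `A/𝔪_A`.
* (private) `isLocalizationAtPrime_comap_maximalIdeal` — a localization `T = M⁻¹B` which is local is `B_P`,
  `P = 𝔪_T ∩ B`.
* `ringKrullDim_le_of_quasiFinite_of_faithfulSMul` — **Thm. 15.5, local form**: `A ↪ T` local, quasi-finite, essentially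
  of finite type, `A` a Noetherian local domain, `T` a local domain ⇒ `dim T ≤ dim A`.
* `ringKrullDim_eq_of_quasiFinite_of_isUniversallyCatenaryRing` — **Thm. 15.6, local form**: if moreover `A` is
  universally catenary then `dim T = dim A`.
* `ringKrullDim_quotient_eq_of_comap_eq_bot` — the same for `T = S/Q` with `Q` a prime of `S` contracting to `(0)`:
  `dim S/Q = dim R` (the dimension count of [Lan2013PELCompactifications, Lem. 6.3.1.11], citing [EGA IV₂ 5.6.4, 5.6.5.3]).

Proof of the dimension statements, as printed (Matsumura §15): `T = B_P` for the finitely generated subalgebra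
`B = A[t₁, …, tₙ] ⊆ T` provided by `EssFiniteType` and `P = 𝔪_T ∩ B`; `B` is a domain algebraic over `A` (quasi-finiteness
of the generic fibre), and `B/P ↪ T/𝔪_T` is algebraic over `A/𝔪_A` (quasi-finiteness of the closed fibre); then
`dim T = dim B_P = ht P = ht 𝔪_A = dim A` is the tree's `ringKrullDim_localization_eq_of_isUniversallyCatenaryRing`
(resp. `≤`, `ringKrullDim_localization_le_of_isAlgebraic`).  HC_CM is proved only modulo the 7 printed citations until
rung 0 closes; nothing here changes that.

## References
* [Matsumura1987] H. Matsumura, *Commutative Ring Theory*, CUP 1986, §15: Thm. 15.1, Thm. 15.5, Thm. 15.6 (pp. 116–119).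
* [Lan2013PELCompactifications] K.-W. Lan, *Arithmetic compactifications of PEL-type Shimura varieties*, Lem. 6.3.1.11
  (p. 417), citing EGA IV₂ 5.4.1, 5.6.4, 5.6.5.3.
-/

namespace Literature.RingTheory.KrullDimension

open IsLocalRing Polynomial TensorProduct
open Literature.AlgebraicGeometry.Resolution

universe u

/-! ## Quasi-finite algebras over a domain are algebraic; the closed fibre of a quasi-finite local homomorphism -/

section QuasiFinite

variable {A T : Type*} [CommRing A] [CommRing T] [Algebra A T]

/-- **A quasi-finite algebra over a domain is algebraic.**  If `T` is quasi-finite over the domain `A` (Mathlib: every fibre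
ring `κ(𝔭) ⊗_A T` is finite over `κ(𝔭)`), then every `t ∈ T` satisfies a nonzero polynomial over `A`: otherwise
`A[X] ↪ T`, and tensoring with the flat `A`-module `K = κ((0)) = Frac A` embeds the infinite-dimensional `K[X]` into the
finite-dimensional generic fibre `K ⊗_A T`. [cite: Matsumura1987, §15 Thm. 15.5 (proof, p. 118)] -/
theorem isAlgebraic_of_quasiFinite [IsDomain A] [Algebra.QuasiFinite A T] : Algebra.IsAlgebraic A T := by
  refine ⟨fun t => ?_⟩
  by_contra ht
  have hinj : Function.Injective (aeval t : A[X] →ₐ[A] T) := transcendental_iff_injective.mp ht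
  haveI : Module.Flat A (⊥ : Ideal A).ResidueField :=
    IsLocalization.flat (⊥ : Ideal A).ResidueField (nonZeroDivisors A)
  haveI : Module.Finite (⊥ : Ideal A).ResidueField ((⊥ : Ideal A).ResidueField ⊗[A] T) :=
    Algebra.QuasiFinite.finite_fiber (S := T) (⊥ : Ideal A)
  have hinj' : Function.Injective
      ((aeval t : A[X] →ₐ[A] T).toLinearMap.baseChange (⊥ : Ideal A).ResidueField) := by
    rw [LinearMap.baseChange_eq_ltensor]
    exact Module.Flat.lTensor_preserves_injective_linearMap _ hinj
  haveI : Module.Finite (⊥ : Ideal A).ResidueField ((⊥ : Ideal A).ResidueField ⊗[A] A[X]) :=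
    Module.Finite.of_injective _ hinj'
  haveI : Module.Finite (⊥ : Ideal A).ResidueField ((⊥ : Ideal A).ResidueField)[X] :=
    Module.Finite.equiv (polyEquivTensor' A (⊥ : Ideal A).ResidueField).symm.toLinearEquiv
  exact Polynomial.transcendental_X (R := (⊥ : Ideal A).ResidueField) (Algebra.IsAlgebraic.isAlgebraic _)

end QuasiFinite

section ClosedFibre

variable {R S : Type*} [CommRing R] [CommRing S] [Algebra R S]

/-- **The closed fibre of a quasi-finite local homomorphism is `𝔪`-primary.**  If `R → S` is a local homomorphism of
local rings and `S` is quasi-finite over `R`, then `𝔪_Sᴺ ⊆ 𝔪_R S` for some `N`: `S/𝔪_R S` is finite over the residue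
field `R/𝔪_R`, hence Artinian, so its maximal ideal is nilpotent (Mathlib
`IsLocalRing.exists_maximalIdeal_pow_le_of_isArtinianRing_quotient`).  This is the hypothesis «`dim S/𝔪_R S = 0`» of
Matsumura Thm. 23.1 ∕ Thm. 15.1 in the quasi-finite case. [cite: Matsumura1987, §15 Thm. 15.1 (p. 116)] -/
theorem exists_maximalIdeal_pow_le_map_of_quasiFinite [IsLocalRing R] [IsLocalRing S]
    [IsLocalHom (algebraMap R S)] [Algebra.QuasiFinite R S] :
    ∃ N : ℕ, maximalIdeal S ^ N ≤ (maximalIdeal R).map (algebraMap R S) := by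
  set J : Ideal S := (maximalIdeal R).map (algebraMap R S) with hJ
  have hJle : J ≤ maximalIdeal S :=
    ((IsLocalRing.local_hom_TFAE (algebraMap R S)).out 0 2).mp ‹IsLocalHom (algebraMap R S)›
  haveI : J.LiesOver (maximalIdeal R) := by
    refine ⟨le_antisymm Ideal.le_comap_map ?_⟩
    calc J.comap (algebraMap R S) ≤ (maximalIdeal S).comap (algebraMap R S) := Ideal.comap_mono hJle
      _ = maximalIdeal R := (Ideal.LiesOver.over (P := maximalIdeal S) (p := maximalIdeal R)).symm
  haveI : Algebra.QuasiFinite (R ⧸ maximalIdeal R) (S ⧸ J) :=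
    Algebra.QuasiFinite.of_restrictScalars R _ _
  haveI : IsArtinianRing (R ⧸ maximalIdeal R) := inferInstanceAs (IsArtinianRing (ResidueField R))
  haveI : Module.Finite (R ⧸ maximalIdeal R) (S ⧸ J) := Module.Finite.of_quasiFinite
  haveI : IsArtinianRing (S ⧸ J) := IsArtinianRing.of_finite (R ⧸ maximalIdeal R) (S ⧸ J)
  exact IsLocalRing.exists_maximalIdeal_pow_le_of_isArtinianRing_quotient J

/-- **Residue extensions of quasi-finite local homomorphisms are finite**: for a local homomorphism `A → T` of local
rings with `T` quasi-finite over `A`, `T/𝔪_T` is a finite `A/𝔪_A`-module (the closed fibre is finite over the residue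
field). [cite: Matsumura1987, §15 Thm. 15.1 (p. 116)] -/
theorem finite_quotient_maximalIdeal_of_quasiFinite {A T : Type*} [CommRing A] [CommRing T] [Algebra A T]
    [IsLocalRing A] [IsLocalRing T] [IsLocalHom (algebraMap A T)] [Algebra.QuasiFinite A T] :
    Module.Finite (A ⧸ maximalIdeal A) (T ⧸ maximalIdeal T) := by
  haveI : Algebra.QuasiFinite (A ⧸ maximalIdeal A) (T ⧸ maximalIdeal T) :=
    Algebra.QuasiFinite.of_restrictScalars A _ _
  haveI : IsArtinianRing (A ⧸ maximalIdeal A) := inferInstanceAs (IsArtinianRing (ResidueField A))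
  exact Module.Finite.of_quasiFinite

end ClosedFibre

/-! ## A local localization is the localization at the contracted maximal ideal -/

section LocalModel

variable {B T : Type*} [CommRing B] [CommRing T] [Algebra B T]

/-- If `T = M⁻¹B` is a localization of `B` and `T` is local, then `T = B_P` for `P = 𝔪_T ∩ B`: every element of `B`
outside `P` is already a unit of `T`. [folklore] -/
private theorem isLocalizationAtPrime_comap_maximalIdeal [IsLocalRing T] (M : Submonoid B) [IsLocalization M T] :
    IsLocalization.AtPrime T ((maximalIdeal T).comap (algebraMap B T)) := by
  refine IsLocalization.of_le M _ (fun m hm => ?_) (fun r hr => ?_)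
  · intro (h : algebraMap B T m ∈ maximalIdeal T)
    exact (IsLocalRing.mem_maximalIdeal _).mp h (IsLocalization.map_units T ⟨m, hm⟩)
  · by_contra hu
    exact hr ((IsLocalRing.mem_maximalIdeal _).mpr hu)

end LocalModel

/-! ## Matsumura Thm. 15.5 ∕ 15.6 for quasi-finite, essentially finite-type local homomorphisms -/

section DimensionFormula

variable {A T : Type u} [CommRing A] [CommRing T] [Algebra A T] [IsLocalRing A] [IsLocalRing T]
  [IsLocalHom (algebraMap A T)] [Algebra.QuasiFinite A T]

/-- The residue algebra `B/(𝔪_T ∩ B)` of an intermediate algebra `A → B → T` embeds into `T/𝔪_T`, so it is algebraic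
over `A/𝔪_A` as soon as `T` is quasi-finite over `A` (closed fibre finite over the residue field). [folklore] -/
private theorem isAlgebraic_quotient_comap_maximalIdeal {B : Type*} [CommRing B] [Algebra A B] [Algebra B T]
    [IsScalarTower A B T] (P : Ideal B) (hP : P = (maximalIdeal T).comap (algebraMap B T))
    [P.LiesOver (maximalIdeal A)] : Algebra.IsAlgebraic (A ⧸ maximalIdeal A) (B ⧸ P) := by
  haveI : Module.Finite (A ⧸ maximalIdeal A) (T ⧸ maximalIdeal T) := finite_quotient_maximalIdeal_of_quasiFinite
  haveI : Nontrivial (A ⧸ maximalIdeal A) := Ideal.Quotient.nontrivial_iff.mpr (Ideal.IsPrime.ne_top inferInstance)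
  haveI : Algebra.IsAlgebraic (A ⧸ maximalIdeal A) (T ⧸ maximalIdeal T) := Algebra.IsAlgebraic.of_finite _ _
  let φ : (B ⧸ P) →ₐ[A ⧸ maximalIdeal A] (T ⧸ maximalIdeal T) :=
    { Ideal.quotientMap (maximalIdeal T) (algebraMap B T) (le_of_eq hP) with
      commutes' := fun a => by
        obtain ⟨a, rfl⟩ := Ideal.Quotient.mk_surjective a
        change Ideal.quotientMap (maximalIdeal T) (algebraMap B T) (le_of_eq hP)
            (algebraMap (A ⧸ maximalIdeal A) (B ⧸ P) (Ideal.Quotient.mk _ a)) =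
          algebraMap (A ⧸ maximalIdeal A) (T ⧸ maximalIdeal T) (Ideal.Quotient.mk _ a)
        rw [Ideal.Quotient.algebraMap_mk_of_liesOver, Ideal.Quotient.algebraMap_mk_of_liesOver,
          Ideal.quotientMap_mk, ← IsScalarTower.algebraMap_apply] }
  have hφ : Function.Injective (Ideal.quotientMap (maximalIdeal T) (algebraMap B T) (le_of_eq hP)) :=
    Ideal.quotientMap_injective' (le_of_eq hP.symm)
  exact Algebra.IsAlgebraic.of_injective φ hφ

variable [Algebra.EssFiniteType A T]

/-- **Matsumura Thm. 15.5, local form (EGA IV₂ 5.6.5).**  Let `A ↪ T` be an injective local homomorphism with `A` a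
Noetherian local domain and `T` a local domain which is quasi-finite and essentially of finite type over `A`.  Then
`dim T ≤ dim A`: `T = B_P` for a finitely generated subalgebra `A ⊆ B ⊆ T` (a domain, algebraic over `A`) and
`P = 𝔪_T ∩ B` over `𝔪_A` with `B/P` algebraic over `A/𝔪_A`, and `dim B_P = ht P ≤ ht 𝔪_A = dim A` by the dimension
inequality. [cite: Matsumura1987, Thm. 15.5] -/
theorem ringKrullDim_le_of_quasiFinite_of_faithfulSMul [IsNoetherianRing A] [IsDomain A] [IsDomain T]
    [FaithfulSMul A T] : ringKrullDim T ≤ ringKrullDim A := by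
  haveI : Algebra.IsAlgebraic A T := isAlgebraic_of_quasiFinite
  haveI : FaithfulSMul A (Algebra.EssFiniteType.subalgebra A T) :=
    (faithfulSMul_iff_algebraMap_injective A _).mpr fun a b h =>
      FaithfulSMul.algebraMap_injective A T (by
        rw [IsScalarTower.algebraMap_apply A (Algebra.EssFiniteType.subalgebra A T) T,
          IsScalarTower.algebraMap_apply A (Algebra.EssFiniteType.subalgebra A T) T, h])
  haveI : Algebra.IsAlgebraic A (Algebra.EssFiniteType.subalgebra A T) :=
    Algebra.IsAlgebraic.of_injective (Algebra.EssFiniteType.subalgebra A T).val Subtype.val_injective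
  haveI : IsLocalization.AtPrime T
      ((maximalIdeal T).comap (algebraMap (Algebra.EssFiniteType.subalgebra A T) T)) :=
    isLocalizationAtPrime_comap_maximalIdeal (Algebra.EssFiniteType.submonoid A T)
  haveI : ((maximalIdeal T).comap (algebraMap (Algebra.EssFiniteType.subalgebra A T) T)).LiesOver
      (maximalIdeal A) :=
    ⟨by rw [Ideal.under_def, Ideal.comap_comap, ← IsScalarTower.algebraMap_eq]
        exact Ideal.LiesOver.over⟩
  haveI := isAlgebraic_quotient_comap_maximalIdeal (A := A) (T := T)
    ((maximalIdeal T).comap (algebraMap (Algebra.EssFiniteType.subalgebra A T) T)) rfl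
  rw [ringKrullDim_eq_of_ringEquiv (IsLocalization.algEquiv
    ((maximalIdeal T).comap (algebraMap (Algebra.EssFiniteType.subalgebra A T) T)).primeCompl T
    (Localization.AtPrime
      ((maximalIdeal T).comap (algebraMap (Algebra.EssFiniteType.subalgebra A T) T)))).toRingEquiv]
  exact ringKrullDim_localization_le_of_isAlgebraic _

/-- **Matsumura Thm. 15.6 (Ratliff), local form (EGA IV₂ 5.6.4: the dimension formula).**  Let `A ↪ T` be an injective
local homomorphism with `A` a universally catenary local domain and `T` a local domain which is quasi-finite and
essentially of finite type over `A`.  Then `dim T = dim A`. [cite: Matsumura1987, Thm. 15.6] -/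
theorem ringKrullDim_eq_of_quasiFinite_of_isUniversallyCatenaryRing [IsDomain A] [IsDomain T] [FaithfulSMul A T]
    (hA : IsUniversallyCatenaryRing A) : ringKrullDim T = ringKrullDim A := by
  haveI : IsNoetherianRing A := hA.1
  haveI : Algebra.IsAlgebraic A T := isAlgebraic_of_quasiFinite
  haveI : FaithfulSMul A (Algebra.EssFiniteType.subalgebra A T) :=
    (faithfulSMul_iff_algebraMap_injective A _).mpr fun a b h =>
      FaithfulSMul.algebraMap_injective A T (by
        rw [IsScalarTower.algebraMap_apply A (Algebra.EssFiniteType.subalgebra A T) T,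
          IsScalarTower.algebraMap_apply A (Algebra.EssFiniteType.subalgebra A T) T, h])
  haveI : Algebra.IsAlgebraic A (Algebra.EssFiniteType.subalgebra A T) :=
    Algebra.IsAlgebraic.of_injective (Algebra.EssFiniteType.subalgebra A T).val Subtype.val_injective
  haveI : IsLocalization.AtPrime T
      ((maximalIdeal T).comap (algebraMap (Algebra.EssFiniteType.subalgebra A T) T)) :=
    isLocalizationAtPrime_comap_maximalIdeal (Algebra.EssFiniteType.submonoid A T)
  haveI : ((maximalIdeal T).comap (algebraMap (Algebra.EssFiniteType.subalgebra A T) T)).LiesOver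
      (maximalIdeal A) :=
    ⟨by rw [Ideal.under_def, Ideal.comap_comap, ← IsScalarTower.algebraMap_eq]
        exact Ideal.LiesOver.over⟩
  haveI := isAlgebraic_quotient_comap_maximalIdeal (A := A) (T := T)
    ((maximalIdeal T).comap (algebraMap (Algebra.EssFiniteType.subalgebra A T) T)) rfl
  rw [ringKrullDim_eq_of_ringEquiv (IsLocalization.algEquiv
    ((maximalIdeal T).comap (algebraMap (Algebra.EssFiniteType.subalgebra A T) T)).primeCompl T
    (Localization.AtPrime
      ((maximalIdeal T).comap (algebraMap (Algebra.EssFiniteType.subalgebra A T) T)))).toRingEquiv]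
  exact ringKrullDim_localization_eq_of_isUniversallyCatenaryRing hA _

end DimensionFormula

/-! ## The form consumed by scheme theory: a prime of `S` contracting to `(0)` -/

section Quotient

variable {R S : Type u} [CommRing R] [CommRing S] [Algebra R S] [IsLocalRing R] [IsLocalRing S]
  [IsLocalHom (algebraMap R S)] [Algebra.QuasiFinite R S] [Algebra.EssFiniteType R S]

/-- **`dim S/Q = dim R` for a minimal-type prime `Q` contracting to `(0)`** ([EGA IV₂ 5.6.4, 5.6.5.3] as used in
[Lan2013PELCompactifications, Lem. 6.3.1.11]): let `R → S` be a local homomorphism of local rings, quasi-finite and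
essentially of finite type, with `R` a universally catenary domain (e.g. regular, or Cohen–Macaulay), and let `Q` be a
prime of `S` with `Q ∩ R = (0)`.  Then `dim S/Q = dim R`. [cite: Matsumura1987, Thm. 15.6] -/
theorem ringKrullDim_quotient_eq_of_comap_eq_bot [IsDomain R] (hR : IsUniversallyCatenaryRing R) (Q : Ideal S)
    [Q.IsPrime] (hQ : Q.comap (algebraMap R S) = ⊥) : ringKrullDim (S ⧸ Q) = ringKrullDim R := by
  haveI : Nontrivial (S ⧸ Q) := Ideal.Quotient.nontrivial_iff.mpr (Ideal.IsPrime.ne_top inferInstance)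
  haveI : IsLocalRing (S ⧸ Q) := IsLocalRing.of_surjective' (Ideal.Quotient.mk Q) Ideal.Quotient.mk_surjective
  haveI : IsLocalHom (Ideal.Quotient.mk Q) := IsLocalHom.of_surjective _ Ideal.Quotient.mk_surjective
  haveI : IsLocalHom (algebraMap R (S ⧸ Q)) := by
    rw [IsScalarTower.algebraMap_eq R S (S ⧸ Q), Ideal.Quotient.algebraMap_eq]; exact RingHom.isLocalHom_comp _ _
  haveI : FaithfulSMul R (S ⧸ Q) := by
    rw [faithfulSMul_iff_algebraMap_injective, RingHom.injective_iff_ker_eq_bot,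
      IsScalarTower.algebraMap_eq R S (S ⧸ Q), Ideal.Quotient.algebraMap_eq, ← RingHom.comap_ker, Ideal.mk_ker]
    exact hQ
  exact ringKrullDim_eq_of_quasiFinite_of_isUniversallyCatenaryRing hR

/-- Without catenarity: `dim S/Q ≤ dim R/(Q ∩ R)`-type bound in the injective case `Q ∩ R = (0)`, `R` a Noetherian local
domain: `dim S/Q ≤ dim R`. [cite: Matsumura1987, Thm. 15.5] -/
theorem ringKrullDim_quotient_le_of_comap_eq_bot [IsNoetherianRing R] [IsDomain R] (Q : Ideal S) [Q.IsPrime]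
    (hQ : Q.comap (algebraMap R S) = ⊥) : ringKrullDim (S ⧸ Q) ≤ ringKrullDim R := by
  haveI : Nontrivial (S ⧸ Q) := Ideal.Quotient.nontrivial_iff.mpr (Ideal.IsPrime.ne_top inferInstance)
  haveI : IsLocalRing (S ⧸ Q) := IsLocalRing.of_surjective' (Ideal.Quotient.mk Q) Ideal.Quotient.mk_surjective
  haveI : IsLocalHom (Ideal.Quotient.mk Q) := IsLocalHom.of_surjective _ Ideal.Quotient.mk_surjective
  haveI : IsLocalHom (algebraMap R (S ⧸ Q)) := by
    rw [IsScalarTower.algebraMap_eq R S (S ⧸ Q), Ideal.Quotient.algebraMap_eq]; exact RingHom.isLocalHom_comp _ _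
  haveI : FaithfulSMul R (S ⧸ Q) := by
    rw [faithfulSMul_iff_algebraMap_injective, RingHom.injective_iff_ker_eq_bot,
      IsScalarTower.algebraMap_eq R S (S ⧸ Q), Ideal.Quotient.algebraMap_eq, ← RingHom.comap_ker, Ideal.mk_ker]
    exact hQ
  exact ringKrullDim_le_of_quasiFinite_of_faithfulSMul

end Quotient

end Literature.RingTheory.KrullDimension
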